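import Summits.CriticalPhenomena.CardyFormulaZ2.Theses.CardyUSTContinuation
import Summits.CriticalPhenomena.CardyFormulaZ2.Theorems.CardyUSTContinuationUniformAnalyticExtensionStubRatioToCrux
import Literature.Probability.LatticeModels.FKTwoArcPartitionPolynomials
import Literature.Probability.LatticeModels.FKIsingRSWProofs
import HarnessLib

/-!
# The probabilistic dictionary of the real-axis cut: `t ∂_t u = Cov_t(1_cross, |ω| + 2k^joint)`
# (crux stmt-CriticalPhenomena-6047 `UniformAnalyticExtension`, route `CardyUSTContinuation`,
# line `registered`, skeleton v8.1, lead c7)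

Skeleton v8.1 states the crux ON THE REAL SEGMENT: δ-uniform Gevrey-1 bounds for the rational
function `f_δ = N_δ/Z_δ` (`N_δ = fkTwoArcCrossingPolynomial R δ .joint`,
`Z_δ = fkTwoArcPartitionPolynomials R δ .joint`) at the points of `[t₁, 1]`
(`realAxis_crux_iff_derivBounds`, p168437).  This file proves the DICTIONARY that turns those
derivatives into lattice-model quantities, i.e. Grimmett's differential formulae
(Grimmett 2006, Thm. 3.12, eqs. (3.13)–(3.14), and Thm. 3.73 with the remark after (3.75): along a
direction `(i₁, i₂)` of the `(log(p/(1-p)), log q)`-plane the derivative of `log Z` is the mean and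
the higher derivatives are the cumulants of `i₁|ω| + i₂ k(ω)`) specialised to the SELF-DUAL line
`p = t/(1+t)`, `q = t²` of the two-arc-wired random-cluster measure, whose direction is
`(i₁, i₂) = (1, 2)` in the variable `log t`:

* `selfDual_integral_eq` — expectations under `φ_t := rcMeasure G (t/(1+t)) (t²) (B₁ ∪ B₂)` are
  `Z(t)⁻¹ Σ_ω t^{H(ω)} F(ω)` with `H(ω) = |ω| + 2k^joint(ω)` and `Z = rcArcPolynomial`;
* `selfDual_mul_deriv_measureReal_eq_cov` — for every event `U` and `t > 0`,
  `t · d/dt φ_t(U) = φ_t[1_U · H] − φ_t(U) · φ_t[H] = Cov_t(1_U, H)`;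
* `selfDual_mul_deriv_ratio_eq_cov` — the same for the route's objects: for `δ > 0`, `t > 0`,
  `t · (N_δ/Z_δ)'(t) = Cov_{Ω_δ, t}(1_{rectCrossing}, H)` under the jointly-wired self-dual measure of
  the discretised conformal rectangle (so `t ∂_t u_R(t, δ) = Cov_t(1_cross, H)` by
  `measureReal_fkDomainMeasure_discreteCrossing`);
* `selfDual_deriv_complex_eq_ofReal` — the complex derivative of `z ↦ N(z)/Z(z)` at a real point is
  the real one, so the order-`1` case of the stub (`crux_derivBounds_one`: `‖(N_δ/Z_δ)'(1)‖ ≤ C`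
  uniformly in `δ`) reads: `|Cov_{Ω_δ, p = 1/2}(1_cross, |ω| + 2k^joint(ω))| ≤ C` under Bernoulli(1/2)
  bond percolation of `Ω_δ` — lead c7's probe (P1).  By Euler's formula `H` is the number of loops of
  the loop representation plus a constant (REPORT-c7 §3).
-/

noncomputable section

open Filter Topology Set Polynomial Metric MeasureTheory
open Literature.Probability Literature.Probability.LatticeModels
open Literature.Probability.RandomPlanarGeometry (ConformalRectangle)

namespace Summit.CriticalPhenomena.CardyFormulaZ2.Cruxes.UniformAnalyticExtension.Birth

section Generic

variable {V : Type*} [Fintype V] [DecidableEq V] (G : SimpleGraph V) [DecidableRel G.Adj]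

/-- `t · (Xⁿ)'(t) = n · tⁿ` (evaluation of the derivative of a monomial of `ℕ[X]` in `ℝ`).
[folklore] -/
theorem selfDual_mul_aeval_derivative_X_pow (t : ℝ) (n : ℕ) :
    t * aeval t (derivative ((X : ℕ[X]) ^ n)) = n * t ^ n := by
  rcases n with _ | n
  · simp
  · rw [derivative_X_pow, map_mul, aeval_C, map_pow, aeval_X, Nat.add_sub_cancel, pow_succ,
      eq_natCast]
    push_cast
    ring

/-- `t · P'(t) = Σᵢ hᵢ t^{hᵢ}` for `P = Σᵢ X^{hᵢ} ∈ ℕ[X]`: along the self-dual line `t ∂_t` acts on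
the generating polynomial by inserting the exponent (Grimmett 2006, proof of Thm. 3.73(a)).
[cite: Grimmett2006, Thm. 3.73] -/
theorem selfDual_mul_aeval_derivative_sum {ι : Type*} (s : Finset ι) (h : ι → ℕ) (t : ℝ) :
    t * aeval t (derivative (∑ i ∈ s, (X : ℕ[X]) ^ h i)) = ∑ i ∈ s, (h i : ℝ) * t ^ h i := by
  rw [derivative_sum, map_sum, Finset.mul_sum]
  exact Finset.sum_congr rfl fun i _ => selfDual_mul_aeval_derivative_X_pow t (h i)

/-- The self-dual generating polynomial is positive at every real `t > 0` (it has natural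
coefficients and the empty configuration contributes). [folklore] -/
theorem selfDual_aeval_rcArcPolynomial_pos {t : ℝ} (ht : 0 < t) (B₁ B₂ : Set V) :
    0 < aeval t (rcArcPolynomial G B₁ B₂ .joint) := by
  have h1t : 1 + t ≠ 0 := by positivity
  have hp : t / (1 + t) ∈ Set.Icc (0 : ℝ) 1 :=
    ⟨div_nonneg ht.le (by positivity), (div_le_one (by positivity)).2 (by linarith)⟩
  have hZ := rcPartitionFunction_pos G hp (by positivity : (0:ℝ) < t ^ 2) (B₁ ∪ B₂)
  rw [rcPartitionFunction_selfDual G h1t] at hZ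
  have hc : 0 < (1 + t)⁻¹ ^ (G.edgeFinset).card := by positivity
  exact pos_of_mul_pos_right hZ hc.le

/-- **Expectations under the self-dual two-arc-wired measure** `φ_t = φ^{B₁ ∪ B₂}_{G, t/(1+t), t²}`:
`φ_t[F] = Z(t)⁻¹ Σ_{ω ⊆ E(G)} t^{|ω| + 2k^joint(ω)} F(ω)` with `Z = rcArcPolynomial G B₁ B₂ joint`
(the common factor `(1+t)^{-|E|}` of the weights cancels). (Grimmett 2006, §1.2 eq. (1.2) and
§6.1 eq. (6.9).) [cite: Grimmett2006, §6.1 eq. (6.9)] -/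
theorem selfDual_integral_eq {t : ℝ} (ht : 0 < t) (B₁ B₂ : Set V)
    (F : Percolation.BondConfig V → ℝ) :
    ∫ ω, F ω ∂(rcMeasure G (t / (1 + t)) (t ^ 2) (B₁ ∪ B₂)) =
      (∑ ω ∈ G.edgeFinset.powerset,
          t ^ (ω.card + 2 * arcClusterCount (↑ω : Percolation.BondConfig V) B₁ B₂ .joint) *
            F (↑ω : Percolation.BondConfig V)) /
        aeval t (rcArcPolynomial G B₁ B₂ .joint) := by
  have h1t : 1 + t ≠ 0 := by positivity
  have hp : t / (1 + t) ∈ Set.Icc (0 : ℝ) 1 :=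
    ⟨div_nonneg ht.le (by positivity), (div_le_one (by positivity)).2 (by linarith)⟩
  have hc : (1 + t)⁻¹ ^ (G.edgeFinset).card ≠ 0 := pow_ne_zero _ (inv_ne_zero h1t)
  rw [integral_rcMeasure G hp (by positivity) (B₁ ∪ B₂) F, rcPartitionFunction_selfDual G h1t,
    Finset.sum_div]
  refine Finset.sum_congr rfl fun ω hω => ?_
  rw [rcWeight_selfDual G h1t _ (Finset.mem_powerset.1 hω), ← arcClusterCount_joint,
    mul_div_mul_left _ _ hc, div_mul_eq_mul_div]

/-- **Grimmett's differential formula on the self-dual line.** For every event `U` and `t > 0`,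
`t · d/dt φ_t(U) = φ_t[1_U · H] − φ_t(U) · φ_t[H]`, `H(ω) = |ω| + 2k^joint(ω)`: the logarithmic
`t`-derivative of a probability along `p = t/(1+t)`, `q = t²` is its covariance with
`|ω| + 2k(ω)` (Grimmett 2006, Thm. 3.12: `d/dp = cov(|η|, ·)/(p(1-p))`, `d/dq = cov(k, ·)/q`, and
`t d/dt = p(1-p) d/dp · (1) + q d/dq · (2)` on this curve). [cite: Grimmett2006, Thm. 3.12] -/
theorem selfDual_mul_deriv_measureReal_eq_cov' {t : ℝ} (ht : 0 < t) (B₁ B₂ : Set V)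
    (U : Set (Percolation.BondConfig V)) :
    t * deriv (fun s : ℝ => (rcMeasure G (s / (1 + s)) (s ^ 2) (B₁ ∪ B₂)).real U) t =
      ∫ ω, U.indicator (fun ω => (ω.ncard : ℝ) + 2 * arcClusterCount ω B₁ B₂ .joint) ω
          ∂(rcMeasure G (t / (1 + t)) (t ^ 2) (B₁ ∪ B₂)) -
        (rcMeasure G (t / (1 + t)) (t ^ 2) (B₁ ∪ B₂)).real U *
          ∫ ω, ((ω.ncard : ℝ) + 2 * arcClusterCount ω B₁ B₂ .joint)
            ∂(rcMeasure G (t / (1 + t)) (t ^ 2) (B₁ ∪ B₂)) := by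
  classical
  set N : ℕ[X] := rcArcPolynomialIn G U B₁ B₂ .joint with hN
  set Z : ℕ[X] := rcArcPolynomial G B₁ B₂ .joint with hZ
  set h : Finset (Sym2 V) → ℕ := fun ω =>
    ω.card + 2 * arcClusterCount (↑ω : Percolation.BondConfig V) B₁ B₂ .joint with hh
  -- the probability is the rational function `N/Z` near `t`
  have hfun : (fun s : ℝ => (rcMeasure G (s / (1 + s)) (s ^ 2) (B₁ ∪ B₂)).real U) =ᶠ[𝓝 t]
      fun s => aeval s N / aeval s Z := by
    filter_upwards [Ioi_mem_nhds ht] with s hs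
    exact measureReal_rcMeasure_selfDual G hs B₁ B₂ U
  have hZt : aeval t Z ≠ 0 := (selfDual_aeval_rcArcPolynomial_pos G ht B₁ B₂).ne'
  have hderiv : deriv (fun s : ℝ => aeval s N / aeval s Z) t =
      (aeval t (derivative N) * aeval t Z - aeval t N * aeval t (derivative Z)) /
        aeval t Z ^ 2 :=
    ((Polynomial.hasDerivAt_aeval N t).div (Polynomial.hasDerivAt_aeval Z t) hZt).deriv
  -- the three expectations as polynomial-weighted sums
  have hEU : (rcMeasure G (t / (1 + t)) (t ^ 2) (B₁ ∪ B₂)).real U = aeval t N / aeval t Z :=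
    measureReal_rcMeasure_selfDual G ht B₁ B₂ U
  have hEH : ∫ ω, ((ω.ncard : ℝ) + 2 * arcClusterCount ω B₁ B₂ .joint)
      ∂(rcMeasure G (t / (1 + t)) (t ^ 2) (B₁ ∪ B₂)) = t * aeval t (derivative Z) / aeval t Z := by
    rw [selfDual_integral_eq G ht]
    congr 1
    have hZsum : Z = ∑ ω ∈ G.edgeFinset.powerset, (X : ℕ[X]) ^ h ω := by
      simp only [hZ, rcArcPolynomial, hh]
    rw [hZsum, selfDual_mul_aeval_derivative_sum]
    refine Finset.sum_congr rfl fun ω _ => ?_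
    rw [Set.ncard_coe_finset, hh]
    push_cast
    ring
  have hEUH : ∫ ω, U.indicator (fun ω => (ω.ncard : ℝ) + 2 * arcClusterCount ω B₁ B₂ .joint) ω
      ∂(rcMeasure G (t / (1 + t)) (t ^ 2) (B₁ ∪ B₂)) = t * aeval t (derivative N) / aeval t Z := by
    rw [selfDual_integral_eq G ht]
    congr 1
    have hNsum : N = ∑ ω ∈ G.edgeFinset.powerset.filter
        (fun ω : Finset (Sym2 V) => (↑ω : Percolation.BondConfig V) ∈ U), (X : ℕ[X]) ^ h ω := by
      simp only [hN, rcArcPolynomialIn, hh]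
    rw [hNsum, selfDual_mul_aeval_derivative_sum, Finset.sum_filter]
    refine Finset.sum_congr rfl fun ω _ => ?_
    by_cases hU : (↑ω : Percolation.BondConfig V) ∈ U
    · rw [if_pos hU, Set.indicator_of_mem hU, Set.ncard_coe_finset, hh]
      push_cast
      ring
    · rw [if_neg hU, Set.indicator_of_notMem hU, mul_zero]
  rw [hfun.deriv_eq, hderiv, hEU, hEH, hEUH]
  field_simp

/-- The complex `t`-derivative of `z ↦ N(z)/Z(z)` at a real point where `Z ≠ 0` is the real one
(both are `(N'Z − NZ')/Z²` evaluated at `t`). [folklore] -/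
theorem selfDual_deriv_complex_eq_ofReal (N Z : ℕ[X]) {t : ℝ} (hZt : aeval t Z ≠ 0) :
    deriv (fun z : ℂ => aeval z N / aeval z Z) (t : ℂ) =
      ((deriv (fun s : ℝ => aeval s N / aeval s Z) t : ℝ) : ℂ) := by
  have hZc : aeval (t : ℂ) Z ≠ 0 := by
    rwa [← ratioToCrux_ofReal_aeval_natPoly, Complex.ofReal_ne_zero]
  have h1 : HasDerivAt (fun z : ℂ => aeval z N / aeval z Z)
      ((aeval (t : ℂ) (derivative N) * aeval (t : ℂ) Z -
          aeval (t : ℂ) N * aeval (t : ℂ) (derivative Z)) / aeval (t : ℂ) Z ^ 2) (t : ℂ) :=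
    (Polynomial.hasDerivAt_aeval N (t : ℂ)).div (Polynomial.hasDerivAt_aeval Z (t : ℂ)) hZc
  have h2 : HasDerivAt (fun s : ℝ => aeval s N / aeval s Z)
      ((aeval t (derivative N) * aeval t Z - aeval t N * aeval t (derivative Z)) / aeval t Z ^ 2) t :=
    (Polynomial.hasDerivAt_aeval N t).div (Polynomial.hasDerivAt_aeval Z t) hZt
  rw [h1.deriv, h2.deriv]
  push_cast
  simp only [ratioToCrux_ofReal_aeval_natPoly]

end Generic

/-- **Grimmett's differential formula on the self-dual line** (registered sub-goal form, all
binders explicit): for every finite graph `G`, arcs `B₁, B₂`, event `U` and `t > 0`,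
`t · d/dt φ_t(U) = φ_t[1_U · H] − φ_t(U) · φ_t[H]` with `H(ω) = |ω| + 2k^joint(ω)` and
`φ_t = rcMeasure G (t/(1+t)) (t²) (B₁ ∪ B₂)`. (Grimmett 2006, Thm. 3.12.)
[cite: Grimmett2006, Thm. 3.12] -/
theorem selfDual_mul_deriv_measureReal_eq_cov :
    ∀ {V : Type*} [Fintype V] [DecidableEq V] (G : SimpleGraph V) [DecidableRel G.Adj] (t : ℝ),
      0 < t → ∀ (B₁ B₂ : Set V) (U : Set (Percolation.BondConfig V)),
        t * deriv (fun s : ℝ => (rcMeasure G (s / (1 + s)) (s ^ 2) (B₁ ∪ B₂)).real U) t =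
          ∫ ω, U.indicator (fun ω => (ω.ncard : ℝ) + 2 * arcClusterCount ω B₁ B₂ .joint) ω
              ∂(rcMeasure G (t / (1 + t)) (t ^ 2) (B₁ ∪ B₂)) -
            (rcMeasure G (t / (1 + t)) (t ^ 2) (B₁ ∪ B₂)).real U *
              ∫ ω, ((ω.ncard : ℝ) + 2 * arcClusterCount ω B₁ B₂ .joint)
                ∂(rcMeasure G (t / (1 + t)) (t ^ 2) (B₁ ∪ B₂)) :=
  fun G _ _ ht B₁ B₂ U => selfDual_mul_deriv_measureReal_eq_cov' G ht B₁ B₂ U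

/-! ### The route's objects: the discretised conformal rectangle -/

section Planar

variable (R : ConformalRectangle) {δ : ℝ}

open scoped Classical in
/-- **`t · (N_δ/Z_δ)'(t) = Cov_t(1_cross, |ω| + 2k^joint(ω))`** for the jointly-wired self-dual
random-cluster measure of the discretised conformal rectangle `Ω_δ` (`δ > 0`, `t > 0`): the
`t`-derivatives controlled by the real-axis stub `stub_derivBounds` are, at order `1`, covariances of
Smirnov's crossing event with `H = |ω| + 2k^joint` under
`φ_t = rcMeasure (domainSubgraph R.carrier δ) (t/(1+t)) (t²) (rectArc 0 ∪ rectArc 2)`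
(whose crossing probability IS `u_R(t, δ) = N_δ(t)/Z_δ(t)`, `measureReal_fkDomainMeasure_discreteCrossing`).
(Grimmett 2006, Thm. 3.12 on the self-dual line.) [cite: Grimmett2006, Thm. 3.12] -/
theorem selfDual_mul_deriv_ratio_eq_cov (hδ : 0 < δ) [Fintype (meshDomain R.carrier δ)] {t : ℝ}
    (ht : 0 < t) :
    t * deriv (fun s : ℝ => aeval s (fkTwoArcCrossingPolynomial R δ ArcWiring.joint) /
        aeval s (fkTwoArcPartitionPolynomials R δ ArcWiring.joint)) t =
      ∫ ω, (rectCrossing R δ).indicator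
            (fun ω => (ω.ncard : ℝ) + 2 * arcClusterCount ω (rectArc R δ 0) (rectArc R δ 2) .joint) ω
          ∂(rcMeasure (domainSubgraph R.carrier δ) (t / (1 + t)) (t ^ 2)
              (rectArc R δ 0 ∪ rectArc R δ 2)) -
        (rcMeasure (domainSubgraph R.carrier δ) (t / (1 + t)) (t ^ 2)
            (rectArc R δ 0 ∪ rectArc R δ 2)).real (rectCrossing R δ) *
          ∫ ω, ((ω.ncard : ℝ) + 2 * arcClusterCount ω (rectArc R δ 0) (rectArc R δ 2) .joint)
            ∂(rcMeasure (domainSubgraph R.carrier δ) (t / (1 + t)) (t ^ 2)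
                (rectArc R δ 0 ∪ rectArc R δ 2)) := by
  classical
  have hfun : (fun s : ℝ => aeval s (fkTwoArcCrossingPolynomial R δ ArcWiring.joint) /
        aeval s (fkTwoArcPartitionPolynomials R δ ArcWiring.joint)) =ᶠ[𝓝 t]
      fun s : ℝ => (rcMeasure (domainSubgraph R.carrier δ) (s / (1 + s)) (s ^ 2)
        (rectArc R δ 0 ∪ rectArc R δ 2)).real (rectCrossing R δ) := by
    filter_upwards [Ioi_mem_nhds ht] with s hs
    rw [measureReal_rcMeasure_selfDual _ hs, fkTwoArcCrossingPolynomial_of_pos R hδ,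
      fkTwoArcPartitionPolynomials_of_pos R hδ]
  rw [hfun.deriv_eq]
  exact selfDual_mul_deriv_measureReal_eq_cov' _ ht _ _ _

open scoped Classical in
/-- **Order one of the real-axis stub, in the lattice model's language.** For `δ > 0`, `t > 0` the
complex derivative appearing in `stub_derivBounds` at `k = 1` satisfies
`t · (N_δ/Z_δ)'(t) = Cov_{Ω_δ, t}(1_cross, |ω| + 2k^joint(ω))` (real number cast to `ℂ`); at
`t = 1` the measure is Bernoulli(1/2) bond percolation of `Ω_δ`, so `crux_derivBounds_one` bounds
`|Cov_δ(1_cross, |ω| + 2k^joint)|` uniformly in `δ` — the statement (P1) probed by Monte Carlo in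
REPORT-c7. [cite: Grimmett2006, Thm. 3.12] -/
theorem selfDual_mul_deriv_complexRatio_eq_cov (hδ : 0 < δ) [Fintype (meshDomain R.carrier δ)]
    {t : ℝ} (ht : 0 < t) :
    (t : ℂ) * deriv (fun z : ℂ => aeval z (fkTwoArcCrossingPolynomial R δ ArcWiring.joint) /
        aeval z (fkTwoArcPartitionPolynomials R δ ArcWiring.joint)) (t : ℂ) =
      ((∫ ω, (rectCrossing R δ).indicator
            (fun ω => (ω.ncard : ℝ) + 2 * arcClusterCount ω (rectArc R δ 0) (rectArc R δ 2) .joint) ω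
          ∂(rcMeasure (domainSubgraph R.carrier δ) (t / (1 + t)) (t ^ 2)
              (rectArc R δ 0 ∪ rectArc R δ 2)) -
        (rcMeasure (domainSubgraph R.carrier δ) (t / (1 + t)) (t ^ 2)
            (rectArc R δ 0 ∪ rectArc R δ 2)).real (rectCrossing R δ) *
          ∫ ω, ((ω.ncard : ℝ) + 2 * arcClusterCount ω (rectArc R δ 0) (rectArc R δ 2) .joint)
            ∂(rcMeasure (domainSubgraph R.carrier δ) (t / (1 + t)) (t ^ 2)
                (rectArc R δ 0 ∪ rectArc R δ 2)) : ℝ) : ℂ) := by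
  have hZt : aeval t (fkTwoArcPartitionPolynomials R δ ArcWiring.joint) ≠ 0 :=
    (ratioToCrux_aeval_partition_pos R hδ ht _).ne'
  rw [selfDual_deriv_complex_eq_ofReal _ _ hZt, ← Complex.ofReal_mul,
    selfDual_mul_deriv_ratio_eq_cov R hδ ht]

end Planar

end Summit.CriticalPhenomena.CardyFormulaZ2.Cruxes.UniformAnalyticExtension.Birth
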